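import Summits.NavierStokesRegularity.NavierStokesRegularity.Theorems.ScenarioCensusRowF1ax
import Summits.NavierStokesRegularity.NavierStokesRegularity.Theorems.ScenarioCensusRowA7h
import Summits.NavierStokesRegularity.NavierStokesRegularity.Theorems.ScenarioCensusRowF1StretchedZoom
import Summits.NavierStokesRegularity.NavierStokesRegularity.Theorems.DssFarFieldSlavingBlowupTypeIDssProfileSimilarityEnstrophyBeltramiLiouville
import Summits.NavierStokesRegularity.NavierStokesRegularity.Theorems.SqueezeCycleSingularZoomWindow
import Summits.NavierStokesRegularity.NavierStokesRegularity.Theorems.ClockStretchingLawClockCeilingZoomDerivLimit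
import Summits.NavierStokesRegularity.NavierStokesRegularity.Theorems.PoloidalWindowDoorPoloidalWindowRigidityVorticityTranslate
import Summits.NavierStokesRegularity.NavierStokesRegularity.Theorems.HalfSpaceWindowDoorCirculationCarryingRigidityWholeSpaceMaxPrinciple
import Literature.Analysis.FluidPDE.TypeIAncientMild
import Literature.Analysis.FluidPDE.WholeSpaceIBP
import Literature.Analysis.FluidPDE.ClassicalSolutionCalculus
import Literature.Analysis.FluidPDE.VorticityEquation
import Literature.Analysis.FluidPDE.TypeIAncientMildClassical
import Summits.NavierStokesRegularity.NavierStokesRegularity.Theorems.DssFarFieldSlavingBlowupTypeIDssProfileSimilarityEnstrophyCrossFlowNoDecayOne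
import Summits.NavierStokesRegularity.NavierStokesRegularity.Theorems.DssFarFieldSlavingBlowupTypeIDssProfileSimilarityEnstrophyTimeOnlyThreshold
import HarnessLib
import Literature.Analysis.FluidPDE.TypeIAncientMildTimeAnalytic
import Literature.Analysis.Calculus.RealAnalyticZeroSetProofs
import Summits.NavierStokesRegularity.NavierStokesRegularity.Theorems.ScenarioCensusRowF1EventSocketEvents

/-!
# Census row F1, MEASURE ⇒ ANALYTIC RIGIDITY (cells F1βd / F1ωd, generic F1[q]d; floors RTB / RVB) — LINE 31 «dense-locus» port, part 1/2: §6 THE DENSE-LOCUS ENGINE —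
# continuous jet DEFECTS, near-locus events (`NearEv`), ASYMPTOTIC DENSITY at the parabolic scale (`DenseNear`), the interface `LocusKills`, reverse Fatou for sets and the
# zoom chart on balls, THE TRANSFER «dense near-locus ⇒ positive-measure exact locus of the blow-up limit», the engine (`locRow_of_kills`, `locFloor_of_kills`,
# `locSlack_iff_rowF1`).  §1–§5 of the line are LINE 27–30 VERBATIM and are taken BY NAME from the landed ports (`open …LiouvilleSocket …SharpTop …ThinTop
# …EventSocket`; not re-declared)

Re-homed for the scenario census (typer seat ns-census-typer-1 g9; the cells F1βd / F1ωd (+ generic F1[q]d) and the floors RTB / RVB are MEMBERS OF RECORD «DECIDED IN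
KERNEL IN FILES» of row F1 since census v1.93 (critic idea-crit-3 g8 PASS 07:07:47Z — no price; ref ns-census-ref g12 PRE-CHECK ✓ §17.3 item 60; lead-presearch label
item 60); this port makes them TREE-decided): VERBATIM PORT of the NEW sections (§6–§8) of ns-idea-3 LINE 31 «dense-locus»,
`pub/ideators/ns-idea-3/lines/dense-locus/line-dense-locus.lean` sha16 021c430dd55ed4f0 (1297 l., lean check rc 0, 0 sorry; its §1–§5 = LINES 27–30 VERBATIM, taken BY NAME
from `ScenarioCensusRowF1Socket*` / `…SharpTop*` / `…ThinTop*` / `…EventSocket*`), split for the 400-line rule into `ScenarioCensusRowF1DenseLocus` (§6) →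
`…DenseLocusRows` (§7–§8 + census KEYS).  Lean text VERBATIM in namespace `…Theorems.ScenarioCensus.DenseLocus` (the line's `…Cruxes.ScenarioCensusRowF1.DenseLocusLine`
re-homed) with `open …LiouvilleSocket …SharpTop …ThinTop …EventSocket`; port edits: `@[conjecture]` on the residuals `BelSlack` / `CalmSlack` (≡ `ScenarioCensus.Row_F1`,
OPEN), one-line docstrings added where missing (gate lint), two uses of a lemma name that two opened ports both declare spelled with its namespace.  Statements untouched.

No census VALUE is moved here (row F1 stays OPEN-WITH-LINE; the members become TREE-decided by name); NS regularity is NOT proved; `Row_F1` is untouched (zero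
movement, `belSlack_iff_rowF1` / `calmSlack_iff_rowF1`); no summit statement is proved by this file. Lemmas that restate already-landed tree declarations are taken BY NAME (gate lint `dedup.landed`): `fderiv_smul_stPull_apply` = `InviscidTop.fderiv_smul_stPull_apply`, `fderiv_smul_stPull` = `InviscidTop.fderiv_smul_stPull`, `fderiv_fderiv_smul_stPull` = `InviscidTop.fderiv_fderiv_smul_stPull`, `tendsto_clm_of_tendsto_apply` = `InviscidTop.tendsto_clm_of_tendsto_apply`, `tendsto_fderiv_fderiv_apply_of_bound` = `InviscidTop.tendsto_fderiv_fderiv_apply_of_bound`, `tendsto_fderiv_fderiv_of_bound` = `InviscidTop.tendsto_fderiv_fderiv_of_bound`, `tendsto_fderiv_fderiv_of_typeI_seq_Ioo` = `InviscidTop.tendsto_fderiv_fderiv_of_typeI_seq_Ioo`, `fderiv3_smul_stPull` = `FrozenTop.fderiv3_smul_stPull`, `tendsto_fderiv3_of_typeI_seq_Ioo` = `FrozenTop.tendsto_fderiv3_of_typeI_seq_Ioo`, `tendsto_physicalTime` = `ColumnarTop.tendsto_physicalTime`, `eventually_fast` = `ColumnarTop.eventually_fast`, `sqrt_timeLag`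 = `StretchedTop.sqrt_timeLag`, `forall_of_forall_ne_zero` = `StretchedTop.forall_of_forall_ne_zero`, `radius_eq` = `FrozenTop.radius_eq`, `jointCond_everywhere₆` = `FrozenTop.jointCond_everywhere₄`, `continuousOn_quad` = `IntegratedStretch.continuousOn_quad`, `sqrt_nu_timeLag` = `IntegratedStretch.sqrt_nu_timeLag`, `sing_of_not_bounded` = `InviscidTop.sing_of_not_bounded`, `exists_singularZoom_package₃` = `FrozenTop.exists_singularZoom_package₃`, `lapD_eq_zero_of_eq_zero` = `FrozenTop.lapD_eq_zero_of_eq_zero`, `measurableSet_top` = `IntegratedStretch.measurableSet_top`.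
-/

-- the summit and its single problem share the name `NavierStokesRegularity` (D-0017 nested layout)
set_option linter.dupNamespace false

noncomputable section

open MeasureTheory Set Function Filter TopologicalSpace Metric
open scoped Topology NNReal ENNReal InnerProductSpace RealInnerProductSpace Laplacian

namespace Summit.NavierStokesRegularity.NavierStokesRegularity.Theorems.ScenarioCensus.DenseLocus

open Literature.Analysis Literature.Analysis.FluidPDE
open Summit.NavierStokesRegularity.NavierStokesRegularity.Theorems
open Summit.NavierStokesRegularity.NavierStokesRegularity.Theorems.ScenarioCensus.LiouvilleSocket
open Summit.NavierStokesRegularity.NavierStokesRegularity.Theorems.ScenarioCensus.SharpTop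
open Summit.NavierStokesRegularity.NavierStokesRegularity.Theorems.ScenarioCensus.ThinTop
open Summit.NavierStokesRegularity.NavierStokesRegularity.Theorems.ScenarioCensus.EventSocket

/-- The axial vector of the zero matrix vanishes. -/
theorem curlOf_zero : curlOf (0 : E3 →L[ℝ] E3) = 0 :=
  curlOfₗ.map_zero

/-- `curlOf` coincides with the tree's bundled `curlCLM` (honest identification: both are the axial-vector map; this
file keeps `curlOf` for its `rfl`-compatibility with `curl`). -/
theorem curlOf_eq_curlCLM (A : E3 →L[ℝ] E3) : curlOf A = curlCLM A := by
  have h := congrFun (curl_eq_curlCLM_comp (fun y : E3 => A y)) 0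
  rw [curl_eq_curlOf, Function.comp_apply, ContinuousLinearMap.fderiv] at h
  exact h

/-- The curl of a constant field vanishes. -/
theorem curl_const (v : E3) (x : E3) : curl (fun _ : E3 => v) x = 0 := by
  rw [curl_eq_curlOf, show fderiv ℝ (fun _ : E3 => v) x = 0 by simp, curlOf_zero]

/-! ## §6 THE DENSE-LOCUS ENGINE (NEW): continuous jet DEFECTS, near-locus events, ASYMPTOTIC DENSITY at the parabolic
scale, the interface `LocusKills` («a positive-measure exact locus on every slice kills `𝒦`»), the transfer
«dense near-locus ⇒ positive-measure exact locus of the blow-up limit» (reverse Fatou + `ε`-diagonal + jet convergence),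
rows / floors / residual -/

section Engine

variable {F : Type*} [NormedAddCommGroup F]

/-- The `ε`-NEAR-LOCUS event of a jet defect `q : Jet → F`: the jets `J` with `‖q J‖ < ε`. -/
def NearEv (q : Jet → F) (ε : ℝ) : Set Jet := {J | ‖q J‖ < ε}

/-- Membership in the near-locus event. -/
theorem mem_nearEv_iff (q : Jet → F) (ε : ℝ) (J : Jet) : J ∈ NearEv q ε ↔ ‖q J‖ < ε := Iff.rfl

/-- The near-locus event of a continuous defect is open. -/
theorem isOpen_nearEv {q : Jet → F} (hq : Continuous q) (ε : ℝ) : IsOpen (NearEv q ε) :=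
  isOpen_lt (continuous_norm.comp hq) continuous_const

/-- The near-locus events increase with `ε`. -/
theorem nearEv_mono (q : Jet → F) {ε₁ ε₂ : ℝ} (h : ε₁ ≤ ε₂) : NearEv q ε₁ ⊆ NearEv q ε₂ :=
  fun _ hJ => lt_of_lt_of_le hJ h

/-- Event slices are monotone in the event. -/
theorem eventSlice_mono {P Q : Set Jet} (h : P ⊆ Q) (T ν : ℝ) (u : ℝ → E3 → E3) (t : ℝ) :
    eventSlice P T ν u t ⊆ eventSlice Q T ν u t := fun _ hx => h hx

/-- The physical reading of the near-locus slice: `x ∈ N^q_ε(t)` iff `‖q(J_u(t,x))‖ < ε`. -/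
theorem mem_eventSlice_nearEv_iff (q : Jet → F) (ε T ν : ℝ) (u : ℝ → E3 → E3) (t : ℝ) (x : E3) :
    x ∈ eventSlice (NearEv q ε) T ν u t ↔ ‖q (physJet T ν u t x)‖ < ε := Iff.rfl

/-- **ASYMPTOTIC DENSITY OF THE NEAR-LOCUS AT THE PARABOLIC SCALE** («`q`-DENSE END»): for some `δ, ρ > 0` and EVERY
`ε > 0`, at all times `t < T` close enough to `T`, in EVERY ball of radius `ρ √(ν (T − t))` the points whose
dimensionless jet is `ε`-close to the locus `{q = 0}` fill at least the fraction `δ` of the ball (in volume). -/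
def DenseNear (q : Jet → F) (T ν : ℝ) (u : ℝ → E3 → E3) : Prop :=
  ∃ δ : ℝ, 0 < δ ∧ ∃ ρ : ℝ, 0 < ρ ∧ ∀ ε : ℝ, 0 < ε → ∃ t₁ : ℝ, t₁ < T ∧ ∀ t ∈ Ioo t₁ T, ∀ x : E3,
    ENNReal.ofReal δ * volume (ball x (ρ * Real.sqrt (ν * (T - t)))) ≤
      volume (eventSlice (NearEv q ε) T ν u t ∩ ball x (ρ * Real.sqrt (ν * (T - t))))

/-- **THE KILL INTERFACE.**  A defect `q` KILLS if every Type-I ancient mild field (class `𝒦_M`, any `M`) whose exact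
locus `{y : q(ancientJet W s y) = 0}` has NON-ZERO measure on EVERY slice `s < 0` is trivial.  (The instances below
discharge this with the joint real-analyticity of `𝒦`, Mityagin's zero-set lemma and a Liouville theorem of the tree.) -/
def LocusKills (q : Jet → F) : Prop :=
  ∀ (M : ℝ) (W : ℝ → E3 → E3), IsTypeIAncientMild M W →
    (∀ s < (0 : ℝ), volume {y : E3 | q (ancientJet W s y) = 0} ≠ 0) → ∀ s < (0 : ℝ), ∀ y : E3, W s y = 0

/-- **Generic row «`q`-DENSE END»**: in the frame of `Row_F1`, asymptotic density of the near-locus at the parabolic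
scale implies smooth extension past `T`. -/
def LocRow (q : Jet → F) : Prop :=
  ∀ (ν T : ℝ), 0 < ν → 0 < T → ∀ (u : ℝ → E3 → E3) (p : ℝ → E3 → ℝ),
    IsClassicalNSSolutionOn (Ico 0 T) ν 0 u p → IsLerayHopfOn T ν 0 (u 0) u → HasRapidSpatialDecay (u 0) →
    IsTypeIBlowup u T → DenseNear q T ν u → HasSmoothExtensionPast ν 0 u T

/-- **Generic floor «RECURRENT `q`-FAR BALLS»**: a maximal Type-I blow-up is NOT `q`-dense at the end: for every
`δ, ρ > 0` there is `ε > 0` such that, at times arbitrarily close to `T`, some parabolic ball `B(x, ρ√(ν(T−t)))` has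
LESS than the fraction `δ` of `ε`-near-locus points (`not_denseNear_iff`). -/
def LocFloor (q : Jet → F) : Prop :=
  ∀ (ν T : ℝ), 0 < ν → 0 < T → ∀ (u : ℝ → E3 → E3) (p : ℝ → E3 → ℝ),
    IsMaximalSmoothSolution ν 0 u p T → IsLerayHopfOn T ν 0 (u 0) u → HasRapidSpatialDecay (u 0) →
    IsTypeIBlowup u T → ¬ DenseNear q T ν u

/-- **Generic residual «`q`-DENSE SLACK»**: every maximal Type-I blow-up IS `q`-dense at the end.  For a continuous
killing defect this is EQUIVALENT to `Row_F1` (`locSlack_iff_rowF1`) — the summit-hard half, isolated, not claimed. -/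
def LocSlack (q : Jet → F) : Prop :=
  ∀ (ν T : ℝ), 0 < ν → 0 < T → ∀ (u : ℝ → E3 → E3) (p : ℝ → E3 → ℝ),
    IsMaximalSmoothSolution ν 0 u p T → IsLerayHopfOn T ν 0 (u 0) u → HasRapidSpatialDecay (u 0) →
    IsTypeIBlowup u T → DenseNear q T ν u

/-- The floor, unfolded: NOT dense means «for all `δ, ρ > 0` some `ε > 0` has, recurrently as `t ↑ T`, a parabolic ball
with near-locus fraction `< δ`». -/
theorem not_denseNear_iff (q : Jet → F) (T ν : ℝ) (u : ℝ → E3 → E3) :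
    ¬ DenseNear q T ν u ↔ ∀ δ : ℝ, 0 < δ → ∀ ρ : ℝ, 0 < ρ → ∃ ε : ℝ, 0 < ε ∧ ∀ t₁ : ℝ, t₁ < T →
      ∃ t ∈ Ioo t₁ T, ∃ x : E3,
        volume (eventSlice (NearEv q ε) T ν u t ∩ ball x (ρ * Real.sqrt (ν * (T - t)))) <
          ENNReal.ofReal δ * volume (ball x (ρ * Real.sqrt (ν * (T - t)))) := by
  simp only [DenseNear, not_exists, not_and, not_forall, not_le, exists_prop]

/-! ### Regularity of physical slices (classical solutions) -/

/-- The physical jet of a classical solution is continuous in `x` at every time of `[0, T)`. -/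
theorem continuous_physJet {T ν : ℝ} {u : ℝ → E3 → E3} {p : ℝ → E3 → ℝ}
    (hsol : IsClassicalNSSolutionOn (Ico 0 T) ν 0 u p) {t : ℝ} (ht : t ∈ Ico 0 T) :
    Continuous (physJet T ν u t) := by
  have hu := hsol.contDiff_velocity ht
  exact (hu.continuous.const_smul (Real.sqrt ((T - t) / ν))).prodMk
    ((hu.continuous_fderiv (by simp)).const_smul (T - t))

/-- The slice of an OPEN event of a classical solution is open at every time of `[0, T)`. -/
theorem isOpen_eventSlice {P : Set Jet} (hP : IsOpen P) {T ν : ℝ} {u : ℝ → E3 → E3} {p : ℝ → E3 → ℝ}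
    (hsol : IsClassicalNSSolutionOn (Ico 0 T) ν 0 u p) {t : ℝ} (ht : t ∈ Ico 0 T) :
    IsOpen (eventSlice P T ν u t) :=
  hP.preimage (continuous_physJet hsol ht)

/-! ### Reverse Fatou for sets and the zoom chart on balls -/

/-- **Reverse Fatou for sets.**  If null-measurable sets `A j ⊆ B`, `μ B < ∞`, eventually have measure `≥ a`, then the
set of points lying in INFINITELY MANY `A j` has measure `≥ a`. -/
theorem le_measure_limsupSet {α : Type*} [MeasurableSpace α] {μ : Measure α} {A : ℕ → Set α} {B : Set α}
    (hA : ∀ j, NullMeasurableSet (A j) μ) (hAB : ∀ j, A j ⊆ B) (hB : μ B ≠ ⊤) {a : ℝ≥0∞}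
    (h : ∀ᶠ j in atTop, a ≤ μ (A j)) : a ≤ μ (⋂ n : ℕ, ⋃ j ≥ n, A j) := by
  have hDm : ∀ n : ℕ, NullMeasurableSet (⋃ j ≥ n, A j) μ :=
    fun n => NullMeasurableSet.iUnion fun j => NullMeasurableSet.iUnion fun _ => hA j
  have hanti : Antitone fun n : ℕ => ⋃ j ≥ n, A j := by
    intro m n hmn
    exact iUnion₂_subset fun j hj => subset_iUnion₂ (s := fun j (_ : j ≥ m) => A j) j (hmn.trans hj)
  have hfin : ∃ n : ℕ, μ (⋃ j ≥ n, A j) ≠ ⊤ :=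
    ⟨0, ne_top_of_le_ne_top hB (measure_mono (iUnion₂_subset fun j _ => hAB j))⟩
  have hlim := tendsto_measure_iInter_atTop hDm hanti hfin
  refine ge_of_tendsto hlim ?_
  filter_upwards [h] with n hn
  exact hn.trans (measure_mono (subset_iUnion₂ (s := fun j (_ : j ≥ n) => A j) n le_rfl))

/-- Membership in the limsup set is «frequently». -/
theorem mem_limsupSet_iff {α : Type*} (A : ℕ → Set α) (y : α) :
    (y ∈ ⋂ n : ℕ, ⋃ j ≥ n, A j) ↔ ∃ᶠ j in atTop, y ∈ A j := by
  simp only [mem_iInter, mem_iUnion, frequently_atTop, exists_prop]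

/-- The zoom chart pulls the concentric ball `B(x₀, l r)` back to `B(0, r)`. -/
theorem preimage_zoom_ball (x₀ : E3) {l : ℝ} (hl : 0 < l) (r : ℝ) :
    (fun y : E3 => x₀ + l • y) ⁻¹' ball x₀ (l * r) = ball 0 r := by
  ext y
  simp only [mem_preimage, mem_ball, dist_eq_norm, add_sub_cancel_left, sub_zero, norm_smul, Real.norm_eq_abs,
    abs_of_pos hl]
  exact ⟨fun h => lt_of_mul_lt_mul_left h hl.le, fun h => mul_lt_mul_of_pos_left h hl⟩

/-- The pulled-back near-locus set at zoom step `j` and similarity time `s`, inside the similarity ball `B(0, r)`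
(guarded by `0 ≤ t_j(s)` so that it is measurable at EVERY step). -/
def zoomNear (q : Jet → F) (ε T ν : ℝ) (u : ℝ → E3 → E3) (x₀ : E3) (β R : ℝ) (c : ℕ → ℝ) (s r : ℝ) (j : ℕ) :
    Set E3 :=
  {y | y ∈ ball (0 : E3) r ∧ 0 ≤ T + c j ^ 2 * β * s ∧
    x₀ + (c j * R) • y ∈ eventSlice (NearEv q ε) T ν u (T + c j ^ 2 * β * s)}

/-- The zoomed near-locus set lies in the ball. -/
theorem zoomNear_subset_ball (q : Jet → F) (ε T ν : ℝ) (u : ℝ → E3 → E3) (x₀ : E3) (β R : ℝ) (c : ℕ → ℝ)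
    (s r : ℝ) (j : ℕ) : zoomNear q ε T ν u x₀ β R c s r j ⊆ ball 0 r := fun _ hy => hy.1

/-- The zoomed near-locus sets are monotone. -/
theorem zoomNear_mono (q : Jet → F) {ε₁ ε₂ : ℝ} (h : ε₁ ≤ ε₂) (T ν : ℝ) (u : ℝ → E3 → E3) (x₀ : E3) (β R : ℝ)
    (c : ℕ → ℝ) (s r : ℝ) (j : ℕ) : zoomNear q ε₁ T ν u x₀ β R c s r j ⊆ zoomNear q ε₂ T ν u x₀ β R c s r j :=
  fun _ hy => ⟨hy.1, hy.2.1, eventSlice_mono (nearEv_mono q h) T ν u _ hy.2.2⟩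

/-- The guarded pulled-back sets are measurable at every step (classical solution, continuous defect, `s < 0`). -/
theorem measurableSet_zoomNear {q : Jet → F} (hq : Continuous q) (ε : ℝ) {T ν : ℝ} {u : ℝ → E3 → E3}
    {p : ℝ → E3 → ℝ} (hsol : IsClassicalNSSolutionOn (Ico 0 T) ν 0 u p) (x₀ : E3) {β : ℝ} (hβ : 0 < β) (R : ℝ)
    {c : ℕ → ℝ} (hcpos : ∀ j, 0 < c j) {s : ℝ} (hs : s < 0) (r : ℝ) (j : ℕ) :
    MeasurableSet (zoomNear q ε T ν u x₀ β R c s r j) := by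
  by_cases h0 : 0 ≤ T + c j ^ 2 * β * s
  · have hlt : T + c j ^ 2 * β * s < T := by
      have : 0 < c j ^ 2 * β := mul_pos (pow_pos (hcpos j) 2) hβ
      nlinarith
    have hopen : IsOpen (eventSlice (NearEv q ε) T ν u (T + c j ^ 2 * β * s)) :=
      isOpen_eventSlice (isOpen_nearEv hq ε) hsol ⟨h0, hlt⟩
    have e : zoomNear q ε T ν u x₀ β R c s r j =
        ball 0 r ∩ (fun y : E3 => x₀ + (c j * R) • y) ⁻¹' eventSlice (NearEv q ε) T ν u (T + c j ^ 2 * β * s) := by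
      ext y
      simp only [zoomNear, mem_setOf_eq, h0, true_and, mem_inter_iff, mem_preimage]
    rw [e]
    exact isOpen_ball.measurableSet.inter (hopen.preimage (by fun_prop)).measurableSet
  · have e : zoomNear q ε T ν u x₀ β R c s r j = ∅ := by
      ext y
      simp only [zoomNear, mem_setOf_eq, h0, false_and, and_false, mem_empty_iff_false]
    rw [e]
    exact MeasurableSet.empty

/-! ### THE TRANSFER: dense near-locus ⇒ positive-measure exact locus of the blow-up limit -/

/-- **Transfer theorem (the heart of the line).**  Along a singular Type-I zoom at `x₀` with value AND gradient
convergence to `W`, asymptotic `δ`-density of the `ε`-near-locus of a continuous defect `q` (every `ε > 0`) forces,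
on EVERY slice `s < 0`, the EXACT locus `{y : q(ancientJet W s y) = 0}` to have NON-ZERO measure (indeed
`≥ δ · vol B(0, ρ√(−s))`).  Proof: the ball `B(x₀, ρ√(ν(T − t_j(s))))` is the zoom image of `B(0, ρ√(−s))`
(`IntegratedStretch.sqrt_nu_timeLag`), so the pulled-back near-locus sets have volume `≥ δ vol B` eventually (exact scaling,
`volume_preimage_zoomSpace`); reverse Fatou gives a set `S_ε` of measure `≥ δ vol B` of points FREQUENTLY
`ε`-near along the zoom; the `S_ε` decrease with `ε`, so `Z = ⋂ₖ S_{1/(k+1)}` still has measure `≥ δ vol B`; and at a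
point of `Z` the limit defect vanishes, since the physical jet converges to the ancient jet (`tendsto_physJet_zoom`)
and `q` is continuous. -/
theorem locus_pos_of_denseNear {q : Jet → F} (hq : Continuous q) {T ν : ℝ} {u : ℝ → E3 → E3} {p : ℝ → E3 → ℝ}
    {x₀ : E3} {α β R : ℝ} {c : ℕ → ℝ} {W : ℝ → E3 → E3}
    (hν : 0 < ν) (hT : 0 < T) (hsol : IsClassicalNSSolutionOn (Ico 0 T) ν 0 u p)
    (hα : 0 < α) (hβ : 0 < β) (hR : 0 < R) (hαR : α * R = β) (hαν : α * Real.sqrt ν = Real.sqrt β)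
    (hcpos : ∀ j, 0 < c j) (hclim : Tendsto c atTop (𝓝 0))
    (hpt : ∀ t < 0, ∀ y : E3,
      Tendsto (fun j => (c j * α) • u (T + c j ^ 2 * β * t) (x₀ + (c j * R) • y)) atTop (𝓝 (W t y)))
    (hgrad : ∀ t < 0, ∀ y : E3,
      Tendsto (fun j => (c j * α * (c j * R)) • fderiv ℝ (u (T + c j ^ 2 * β * t)) (x₀ + (c j * R) • y)) atTop
        (𝓝 (fderiv ℝ (W t) y)))
    (hD : DenseNear q T ν u) : ∀ s < (0 : ℝ), volume {y : E3 | q (ancientJet W s y) = 0} ≠ 0 := by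
  intro s hs
  obtain ⟨δ, hδ, ρ, hρ, hden⟩ := hD
  have hs' : 0 < -s := neg_pos.2 hs
  have hrpos : 0 < ρ * Real.sqrt (-s) := mul_pos hρ (Real.sqrt_pos.2 hs')
  -- notation-free abbreviations are avoided; the pulled-back sets are `zoomNear … j`
  have hτlim : Tendsto (fun j => T + c j ^ 2 * β * s) atTop (𝓝[<] T) := ColumnarTop.tendsto_physicalTime hβ hs hcpos hclim
  have hmeas : ∀ ε j, MeasurableSet (zoomNear q ε T ν u x₀ β R c s (ρ * Real.sqrt (-s)) j) :=
    fun ε j => measurableSet_zoomNear hq ε hsol x₀ hβ R hcpos hs _ j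
  have hballfin : volume (ball (0 : E3) (ρ * Real.sqrt (-s))) ≠ ⊤ := measure_ball_lt_top.ne
  -- Step 1: eventual volume lower bound of the pulled-back near-locus sets
  have step1 : ∀ ε : ℝ, 0 < ε → ∀ᶠ j in atTop,
      ENNReal.ofReal δ * volume (ball (0 : E3) (ρ * Real.sqrt (-s))) ≤
        volume (zoomNear q ε T ν u x₀ β R c s (ρ * Real.sqrt (-s)) j) := by
    intro ε hε
    obtain ⟨t₁, ht₁, hb⟩ := hden ε hε
    have hev1 : ∀ᶠ j in atTop, T + c j ^ 2 * β * s ∈ Ioo t₁ T := hτlim.eventually (Ioo_mem_nhdsLT ht₁)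
    have hev2 : ∀ᶠ j in atTop, T + c j ^ 2 * β * s ∈ Ioo 0 T := hτlim.eventually (Ioo_mem_nhdsLT hT)
    filter_upwards [hev1, hev2] with j hj hj0
    have hcj := hcpos j
    have hl : 0 < c j * R := mul_pos hcj hR
    have hrad : ρ * Real.sqrt (ν * (T - (T + c j ^ 2 * β * s))) = (c j * R) * (ρ * Real.sqrt (-s)) := by
      rw [IntegratedStretch.sqrt_nu_timeLag hν hα hβ hαR hαν hcpos j]; ring
    have hball : (fun y : E3 => x₀ + (c j * R) • y) ⁻¹' ball x₀ (ρ * Real.sqrt (ν * (T - (T + c j ^ 2 * β * s)))) =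
        ball 0 (ρ * Real.sqrt (-s)) := by
      rw [hrad]; exact preimage_zoom_ball x₀ hl _
    have key := hb (T + c j ^ 2 * β * s) hj x₀
    have hvol : ∀ E : Set E3, volume ((fun y : E3 => x₀ + (c j * R) • y) ⁻¹' E) =
        ENNReal.ofReal (((c j * R) ^ 3)⁻¹) * volume E := fun E => volume_preimage_zoomSpace hl x₀ E
    have e1 : zoomNear q ε T ν u x₀ β R c s (ρ * Real.sqrt (-s)) j = (fun y : E3 => x₀ + (c j * R) • y) ⁻¹'
        (eventSlice (NearEv q ε) T ν u (T + c j ^ 2 * β * s) ∩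
          ball x₀ (ρ * Real.sqrt (ν * (T - (T + c j ^ 2 * β * s))))) := by
      rw [preimage_inter, hball, inter_comm]
      ext y
      simp only [zoomNear, mem_setOf_eq, hj0.1.le, true_and, mem_inter_iff, mem_preimage]
    rw [e1, hvol, ← hball, hvol, mul_left_comm]
    exact mul_le_mul' le_rfl key
  -- Step 2: the limsup sets `S ε` have measure ≥ δ vol B
  have step2 : ∀ ε : ℝ, 0 < ε → ENNReal.ofReal δ * volume (ball (0 : E3) (ρ * Real.sqrt (-s))) ≤
      volume (⋂ n : ℕ, ⋃ j ≥ n, zoomNear q ε T ν u x₀ β R c s (ρ * Real.sqrt (-s)) j) :=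
    fun ε hε => le_measure_limsupSet (fun j => (hmeas ε j).nullMeasurableSet)
      (fun j => zoomNear_subset_ball q ε T ν u x₀ β R c s _ j) hballfin (step1 ε hε)
  -- Step 3: the diagonal intersection over ε = 1/(k+1)
  have hSmeas : ∀ k : ℕ, NullMeasurableSet
      (⋂ n : ℕ, ⋃ j ≥ n, zoomNear q (1 / ((k : ℝ) + 1)) T ν u x₀ β R c s (ρ * Real.sqrt (-s)) j) volume :=
    fun k => (MeasurableSet.iInter fun n => MeasurableSet.iUnion fun j =>
      MeasurableSet.iUnion fun _ => hmeas _ j).nullMeasurableSet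
  have hSanti : Antitone fun k : ℕ =>
      ⋂ n : ℕ, ⋃ j ≥ n, zoomNear q (1 / ((k : ℝ) + 1)) T ν u x₀ β R c s (ρ * Real.sqrt (-s)) j := by
    intro k l hkl
    have hkl' : (k : ℝ) ≤ l := by exact_mod_cast hkl
    have hε : 1 / ((l : ℝ) + 1) ≤ 1 / ((k : ℝ) + 1) := one_div_le_one_div_of_le (by positivity) (by linarith)
    exact iInter_mono fun n => iUnion₂_mono fun j _ => zoomNear_mono q hε T ν u x₀ β R c s _ j
  have hSfin : ∃ k : ℕ, volume
      (⋂ n : ℕ, ⋃ j ≥ n, zoomNear q (1 / ((k : ℝ) + 1)) T ν u x₀ β R c s (ρ * Real.sqrt (-s)) j) ≠ ⊤ :=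
    ⟨0, ne_top_of_le_ne_top hballfin (measure_mono (iInter_subset_of_subset 0
      (iUnion₂_subset fun j _ => zoomNear_subset_ball q _ T ν u x₀ β R c s _ j)))⟩
  have hZ : ENNReal.ofReal δ * volume (ball (0 : E3) (ρ * Real.sqrt (-s))) ≤
      volume (⋂ k : ℕ, ⋂ n : ℕ, ⋃ j ≥ n, zoomNear q (1 / ((k : ℝ) + 1)) T ν u x₀ β R c s (ρ * Real.sqrt (-s)) j) :=
    ge_of_tendsto (tendsto_measure_iInter_atTop hSmeas hSanti hSfin)
      (Eventually.of_forall fun k => step2 _ (by positivity))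
  -- Step 4: on the diagonal intersection the limit defect vanishes
  have hsub : (⋂ k : ℕ, ⋂ n : ℕ, ⋃ j ≥ n, zoomNear q (1 / ((k : ℝ) + 1)) T ν u x₀ β R c s (ρ * Real.sqrt (-s)) j)
      ⊆ {y : E3 | q (ancientJet W s y) = 0} := by
    intro y hy
    rw [mem_setOf_eq]
    by_contra hne
    have hd : 0 < ‖q (ancientJet W s y)‖ := norm_pos_iff.2 hne
    obtain ⟨k, hk⟩ := exists_nat_one_div_lt (half_pos hd)
    have hlim : Tendsto (fun j => ‖q (physJet T ν u (T + c j ^ 2 * β * s) (x₀ + (c j * R) • y))‖) atTop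
        (𝓝 ‖q (ancientJet W s y)‖) :=
      ((continuous_norm.comp hq).tendsto _).comp (tendsto_physJet_zoom hν hα hβ hαR hαν hcpos hpt hgrad hs y)
    have hev : ∀ᶠ j in atTop, ‖q (ancientJet W s y)‖ / 2 <
        ‖q (physJet T ν u (T + c j ^ 2 * β * s) (x₀ + (c j * R) • y))‖ :=
      (tendsto_order.1 hlim).1 _ (by linarith)
    have hyk := mem_iInter.1 hy k
    have hfreq : ∃ᶠ j in atTop,
        y ∈ zoomNear q (1 / ((k : ℝ) + 1)) T ν u x₀ β R c s (ρ * Real.sqrt (-s)) j :=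
      (mem_limsupSet_iff _ y).1 hyk
    obtain ⟨j, hjmem, hjev⟩ := (hfreq.and_eventually hev).exists
    have hlt : ‖q (physJet T ν u (T + c j ^ 2 * β * s) (x₀ + (c j * R) • y))‖ < 1 / ((k : ℝ) + 1) := hjmem.2.2
    linarith
  have hpos : 0 < ENNReal.ofReal δ * volume (ball (0 : E3) (ρ * Real.sqrt (-s))) :=
    ENNReal.mul_pos (ENNReal.ofReal_pos.2 hδ).ne' (measure_ball_pos volume (0 : E3) hrpos).ne'
  exact (hpos.trans_le (hZ.trans (measure_mono hsub))).ne'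

/-! ### The engine: rows, floors and the residual from a continuous killing defect -/

/-- **Engine (row).**  A continuous killing defect gives the row «`q`-DENSE END ⇒ smooth extension». -/
theorem locRow_of_kills {q : Jet → F} (hq : Continuous q) (hK : LocusKills q) : LocRow q := by
  intro ν T hν hT u p hsol hLH hdec hTI hD
  obtain ⟨M, hM⟩ := exists_isTypeIBlowupWith hν hTI
  apply hasSmoothExtensionPast_of_forall_exists_parabolicCylinder hν hT hsol hLH hdec
  intro x₀
  by_contra hno
  obtain ⟨α, β, R, c, W, hα, hβ, hR, hαR, hαν, hcpos, hclim, hW, hpt, hgrad, -, -, t, ht, y, hne⟩ :=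
    FrozenTop.exists_singularZoom_package₃ hν hT hsol hLH hdec hM x₀ (InviscidTop.sing_of_not_bounded hno)
  exact hne (hK M W hW (locus_pos_of_denseNear hq hν hT hsol hα hβ hR hαR hαν hcpos hclim hpt hgrad hD) t ht y)

/-- **Engine (floor).**  A continuous killing defect gives the floor «maximal Type-I blow-up ⇒ NOT `q`-dense». -/
theorem locFloor_of_kills {q : Jet → F} (hq : Continuous q) (hK : LocusKills q) : LocFloor q := by
  intro ν T hν hT u p hmax hLH hdec hTI hD
  exact hmax.2 (locRow_of_kills hq hK ν T hν hT u p hmax.1 hLH hdec hTI hD)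

/-- **Split**: the row and the slack give `Row_F1`. -/
theorem rowF1_of_locRow {q : Jet → F} (hR : LocRow q) (hS : LocSlack q) : ScenarioCensus.Row_F1 := by
  unfold ScenarioCensus.Row_F1
  intro ν T hν hT u p hsol hLH hdec hTI
  by_contra hext
  exact hext (hR ν T hν hT u p hsol hLH hdec hTI (hS ν T hν hT u p ⟨hsol, hext⟩ hLH hdec hTI))

/-- `Row_F1` gives every slack vacuously. -/
theorem locSlack_of_rowF1 (q : Jet → F) (h : ScenarioCensus.Row_F1) : LocSlack q :=
  fun ν T hν hT u p hmax hLH hdec hTI => absurd (h ν T hν hT u p hmax.1 hLH hdec hTI) hmax.2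

/-- **The residual of a continuous killing defect is EQUIVALENT to `Row_F1`** (honest label: summit-hard). -/
theorem locSlack_iff_rowF1 {q : Jet → F} (hq : Continuous q) (hK : LocusKills q) :
    LocSlack q ↔ ScenarioCensus.Row_F1 :=
  ⟨rowF1_of_locRow (locRow_of_kills hq hK), locSlack_of_rowF1 q⟩

/-- Floor and slack together exclude maximal Type-I blow-up data outright. -/
theorem locFloor_locSlack_exclude {q : Jet → F} (hF : LocFloor q) (hS : LocSlack q) :
    ∀ (ν T : ℝ), 0 < ν → 0 < T → ∀ (u : ℝ → E3 → E3) (p : ℝ → E3 → ℝ),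
      IsMaximalSmoothSolution ν 0 u p T → IsLerayHopfOn T ν 0 (u 0) u → HasRapidSpatialDecay (u 0) →
      ¬ IsTypeIBlowup u T :=
  fun ν T hν hT u p hmax hLH hdec hTI => hF ν T hν hT u p hmax hLH hdec hTI (hS ν T hν hT u p hmax hLH hdec hTI)

end Engine

end Summit.NavierStokesRegularity.NavierStokesRegularity.Theorems.ScenarioCensus.DenseLocus

end
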